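import Literature.MathematicalPhysics.QuantumFieldTheory.ConformalBootstrap3D.PointKernelK34L505Data
import Literature.MathematicalPhysics.QuantumFieldTheory.ConformalBootstrap3D.PointKernelK34L505Segs
import Literature.MathematicalPhysics.QuantumFieldTheory.ConformalBootstrap3D.PointKernelParts

/-!
# K34L505 certificate, kernel part file P24: one-cell head segments 95, 96 in level ranges

The head cells whose kernel evaluation exceeds one `decide` are one-cell segments of `hsegsK34L505`; each is
checked by `PCert.hPartSideOK` (side conditions) and `PCert.hPartOK` per level range `[n_lo, n_lo + count)`
against an integer claim, the claims summing to `≥ 0` (`PointKernel.partsOK`); soundness is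
`PCert.hParts_sound` (`PointKernelParts`).  The part files are mutually independent (each imports only
the data file); the ranges of one cell may span several of them, and the per-cell conclusions
`hparts_i` / `hcell_i` of those cells are assembled in `PointKernelK34L505.lean`.
Estimated kernel time 246 s.
-/

set_option maxRecDepth 100000
set_option maxHeartbeats 0

namespace Literature.MathematicalPhysics.QuantumFieldTheory.ConformalBootstrap3D.PointKernelK34L505

open Literature.MathematicalPhysics.QuantumFieldTheory.ConformalBootstrap3D.PointKernel

/-- levels `[71, 73)` of segment 95: partial lower sum `≥` claim. [folklore] -/
theorem part_95_9 : certK34L505.hPartOK (PCert.segAt hsegsK34L505 95) JHK34L505 71 2 (38994617920733880054879005238028836) = true := by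
  decide +kernel

/-- one-cell segment 96 (row 6, cell `[14337/2048, 28675/4096]`, chord, `n_F = 72`,
10 level ranges): side conditions. [folklore] -/
theorem pside_96 : certK34L505.hPartSideOK (PCert.segAt hsegsK34L505 96) JHK34L505 = true := by
  decide +kernel

/-- its level ranges `(n_lo, count, claim)`. [folklore] -/
def partsK34L505_96 : List (ℕ × ℕ × ℤ) := [(0, 25, -28569438922375569918654818239402174439), (25, 11, 18384911041659175103191709873111257433), (36, 8, 5990697492668524819881185124676439055), (44, 6, 2144259539386295849314221694093783398), (50, 5, 970664425436452803229590794551535028), (55, 5, 552613350753734382035250663450628643), (60, 4, 259532368436076015695888878639361905), (64, 4, 161046138921656794501612194617219794), (68, 3, 74734097045012836931696081227636905), (71, 2, 30980468068641313873662935034312282)]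

/-- the ranges tile `[0, n_F]` and the claims sum to `≥ 0`. [folklore] -/
theorem pcov_96 : PointKernel.partsOK 72 partsK34L505_96 = true := by
  decide +kernel

/-- levels `[0, 25)` of segment 96: partial lower sum `≥` claim. [folklore] -/
theorem part_96_0 : certK34L505.hPartOK (PCert.segAt hsegsK34L505 96) JHK34L505 0 25 (-28569438922375569918654818239402174439) = true := by
  decide +kernel

/-- levels `[25, 36)` of segment 96: partial lower sum `≥` claim. [folklore] -/
theorem part_96_1 : certK34L505.hPartOK (PCert.segAt hsegsK34L505 96) JHK34L505 25 11 (18384911041659175103191709873111257433) = true := by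
  decide +kernel

/-- levels `[36, 44)` of segment 96: partial lower sum `≥` claim. [folklore] -/
theorem part_96_2 : certK34L505.hPartOK (PCert.segAt hsegsK34L505 96) JHK34L505 36 8 (5990697492668524819881185124676439055) = true := by
  decide +kernel

end Literature.MathematicalPhysics.QuantumFieldTheory.ConformalBootstrap3D.PointKernelK34L505
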